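/-
Copyright (c) 2026 the pub-hodgecm-mathlib formalisation cell (harness21).  Prover seat hodgecm-mathlib-K2E1-p10 (g2), Track B ∕ K2-LIT (build stream 29), h413 = `stmt-HodgeConjecture-24833`,
route of record `HCCMUnconditional`, ROADCARD «5Res ENDGAME BY FAMILIES» §2 C7; dealer K2E1-plan (g7) (259) — THE NAMED (∀-GUARDED) C7 PRINTS repairing boxer T129 F1 «junk-∃
export»: every conclusion is stated FOR EVERY Borel parabolic datum `𝔓` with `Nonempty 𝔓.ι` (so the consumer instantiates the datum it names; the junk `⟨PEmpty, nofun⟩` is excluded).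
-/
import Summits.HodgeConjecture.HodgeConjecture.Theorems.K2E1PseudoEisensteinFamilyDecompositionU2      -- ★ THE C7 HEAD (this seat): §2 `toLp_quotFun_eisensteinSeriesU_mem_span_family` + imports
import Summits.HodgeConjecture.HodgeConjecture.Theorems.K2E1CuspidalDensityQuasiSplitBridgeCMTwo      -- ★ bridge (this seat): `(𝔓, h𝔓, W, hE)` in the quasiSplit world
import Summits.HodgeConjecture.HodgeConjecture.Theorems.K2E1EisensteinNiceClassCMTwo                  -- ★ F3d-δ (K2E1-p15): `memLp_quotFun_eisensteinSeriesU_of_nice`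
import Summits.HodgeConjecture.HodgeConjecture.Theorems.K2E1ChiSectionLevelFinitenessU2               -- ★ F3d-ε (this seat): the finite index `S(K′)` (`finite_setOf_rayTrivial_levelTrivial`)
import Summits.HodgeConjecture.HodgeConjecture.Theorems.K2E1NormOneTorusFamilyApproxU2                  -- ★ F3d-α (K2E1-p12): `exists_finset_heckeCharacter_family_decomposition`
import HarnessLib

/-!
# h413 ∕ Track B «K2-LIT», ROADCARD «5Res BY FAMILIES» §2 C7 — `K2E1PseudoEisensteinFamilyDecompositionNamedU2`: THE ∀-GUARDED (NAMED-DATUM) C7 PRINTS — for EVERY Borel parabolic datum `𝔓`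
# of `quasiSplit L⁺ L c 2` (`Nonempty 𝔓.ι`, all radicals `= adelicUnipotent`): `((cusp μ 𝔓)ᗮ ∩ L²(X)^{K′}) ⊆ closure ⨆_χ span { [quotFun (E (f(H)·φ))] }` (all `χ`, and the finite `S(K′)`), letter-free

Cell `pub/hodgecm-mathlib`, crux h413 = `stmt-HodgeConjecture-24833`, route of record `HCCMUnconditional`; dealer K2E1-plan (g7) (259) after boxer K2E1-r01 T129 F1.  THEOREMS ONLY; lane
`--supports stmt-HodgeConjecture-24833 --as helper` (count-neutral).  Closes no socket.  WHY: the earlier prints (★ p860460∕p860626∕p860672∕p860699) conclude `∃ 𝔓, … ∧ Claim(cusp μ 𝔓)`,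
which the junk datum `⟨PEmpty, nofun⟩` satisfies vacuously; here every head is `∀ 𝔓, Nonempty 𝔓.ι → (∀ i, 𝔓.radical i = N(𝔸)) → Claim(cusp μ 𝔓)`, fed by the ∀-guarded bridge ★∕📤
`orthogonal_eq_topologicalClosure_span_of_borel` (cusp space and generators depend only on the set of radicals).  The consumer (K2E4-p23 `hPEis`, K2E4-p14 `hEXH`) instantiates `𝔓` with the
datum it names (e.g. the transport of ★ `cmParabolicData L 2`, index `{1}`).

* §1 **`cuspidal_orthogonal_inf_invariants_le_topologicalClosure_biSup_levelFamilies_named`** (finite index `S(K′)`, `hα` hypothesis-first; proof = ★ `…FiniteU2` with the datum as a parameter).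
* §2 **`…_iSup_family_named_of_bricks`** (all `χ`), **`…_biSup_levelFamilies_named_of_bricks`** (finite `S(K′)`), **`finite_blocks_named`** (block currency of ★ `hEXH_of_orthogonalBlocks`) — LETTER-FREE.

HONEST LABEL: HC_CM is proved only modulo the 7 printed citations (2 remaining named inputs: hLiu418 = `stmt-HodgeConjecture-24832`, h413 = `stmt-HodgeConjecture-24833`) until rung 0
closes; this file asserts no named fact and closes no socket.
References: [MoeglinWaldspurger1995] C. Mœglin, J.-L. Waldspurger, *Spectral Decomposition and Eisenstein Series*, II.1.1–II.1.4, II.2.4; [BernsteinLapid2019] J. Bernstein, E. Lapid, *On the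
meromorphic continuation of Eisenstein series*, §4.
-/

set_option autoImplicit false
set_option linter.dupNamespace false  -- the mandated namespace repeats the summit's segment (`HodgeConjecture.HodgeConjecture`)

noncomputable section

open MeasureTheory Measure Set Filter Topology NumberField
open Literature.MeasureTheory.Group Literature.NumberTheory.Automorphic Literature.NumberTheory.Automorphic.UnitaryGroup Literature.NumberTheory.GaloisRepresentations AdelicGroupData ContRepresentation
open Summit.HodgeConjecture.HodgeConjecture.Cruxes.H413.K2E1BorelEisensteinU
open Summit.HodgeConjecture.HodgeConjecture.Cruxes.H413.K2E1CharacterEisensteinU2Defs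
open Summit.HodgeConjecture.HodgeConjecture.Cruxes.H413.K2E1ChiSectionSpaceU2Defs
open Summit.HodgeConjecture.HodgeConjecture.Cruxes.H413.K2E1PseudoEisensteinNiceGeneratorsU (orthogonal_inf_invariants_eq_topologicalClosure_span_nice)
open Summit.HodgeConjecture.HodgeConjecture.Cruxes.H413.K2E1PseudoEisensteinBorelPeriodizationU2
open Summit.HodgeConjecture.HodgeConjecture.Cruxes.H413.K2E1PseudoEisensteinBorelPeriodizationContinuousU2
open Summit.HodgeConjecture.HodgeConjecture.Cruxes.H413.K2E1EisensteinSupNormBandBoundCMTwo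
open Summit.HodgeConjecture.HodgeConjecture.Cruxes.H413.K2E1ChiIsotypicPureTensorDecompositionU2 (chi_firstEntryUnit_eq_one_of_apply_ne_zero)
open Summit.HodgeConjecture.HodgeConjecture.Cruxes.H413.K2E1PseudoEisensteinFamilyDecompositionU2 (isClosed_adelicUnipotent_quasiSplit_cm toLp_quotFun_eisensteinSeriesU_mem_span_family)
open Summit.HodgeConjecture.HodgeConjecture.Cruxes.H413.K2E1CuspidalDensityQuasiSplitBridgeCMTwo (orthogonal_eq_topologicalClosure_span_of_borel)
open Summit.HodgeConjecture.HodgeConjecture.Cruxes.H413.K2E1PseudoEisensteinFamilyDecompositionU2 (orthogonal_inf_invariants_le_topologicalClosure_iSup_family)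
open Summit.HodgeConjecture.HodgeConjecture.Cruxes.H413.K2E1ChiSectionLevelFinitenessU2 (finite_setOf_rayTrivial_levelTrivial)
open Summit.HodgeConjecture.HodgeConjecture.Cruxes.H413.K2E1NormOneTorusFamilyApproxU2 (exists_finset_heckeCharacter_family_decomposition)
open Summit.HodgeConjecture.HodgeConjecture.Cruxes.H413.K2E1EisensteinNiceClassCMTwo (memLp_quotFun_eisensteinSeriesU_of_nice)
open scoped ENNReal NNReal Pointwise

namespace Summit.HodgeConjecture.HodgeConjecture.Cruxes.H413.K2E1PseudoEisensteinFamilyDecompositionNamedU2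

variable (L : Type) [Field L] [NumberField L] [IsCMField L]
  (μ : Measure (quasiSplit (↥(maximalRealSubfield L)) L (IsCMField.complexConj L) 2).automorphicQuotient)

/-! ## §1 The finite-index head for a NAMED datum (hα hypothesis-first) -/

set_option maxHeartbeats 400000 in
/-- **C7 WITH FINITE INDEX FOR A NAMED BOREL DATUM** (`hα` hypothesis-first): for EVERY `𝔓` with `Nonempty 𝔓.ι` and all radicals `= N(𝔸)`,
`(cusp μ 𝔓)ᗮ ∩ L²(X)^{K′} ≤ closure ⨆_{χ ∈ S(K′)} span(pure-tensor classes)`. [cite: MoeglinWaldspurger1995, II.1.1–II.1.4, II.2.4] [cite: BernsteinLapid2019, §4] -/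
theorem cuspidal_orthogonal_inf_invariants_le_topologicalClosure_biSup_levelFamilies_named (hc : IsCMField.complexConj L * IsCMField.complexConj L = 1)
    (𝔓 : (quasiSplit (↥(maximalRealSubfield L)) L (IsCMField.complexConj L) 2).ParabolicUnipotentData) (hne : Nonempty 𝔓.ι) (h𝔓 : ∀ i : 𝔓.ι, 𝔓.radical i = adelicUnipotent (↥(maximalRealSubfield L)) L (IsCMField.complexConj L) 2)
    [MeasurableSpace (quasiSplit (↥(maximalRealSubfield L)) L (IsCMField.complexConj L) 2).Adelic] [BorelSpace (quasiSplit (↥(maximalRealSubfield L)) L (IsCMField.complexConj L) 2).Adelic]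
    [(quasiSplit (↥(maximalRealSubfield L)) L (IsCMField.complexConj L) 2).IsAutomorphicMeasure μ]
    (ν : Measure (quasiSplit (↥(maximalRealSubfield L)) L (IsCMField.complexConj L) 2).Adelic) [ν.IsHaarMeasure]
    (K' : Subgroup (quasiSplit (↥(maximalRealSubfield L)) L (IsCMField.complexConj L) 2).Adelic) (hK'o : IsOpen (K' : Set (quasiSplit (↥(maximalRealSubfield L)) L (IsCMField.complexConj L) 2).Adelic))
    (hK'c : IsCompact (K' : Set (quasiSplit (↥(maximalRealSubfield L)) L (IsCMField.complexConj L) 2).Adelic))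
    (hHK' : ∀ (g k : (quasiSplit (↥(maximalRealSubfield L)) L (IsCMField.complexConj L) 2).Adelic), k ∈ K' → borelHeight (g * k) = borelHeight g)
    (W : Finset (quasiSplit (↥(maximalRealSubfield L)) L (IsCMField.complexConj L) 2).Adelic) (hW : ∀ g, ∃ β ∈ borelAdelic (↥(maximalRealSubfield L)) L (IsCMField.complexConj L) 2, ∃ w ∈ W, ∃ k ∈ K', g = β * w * k)
    (μK : Measure ↥K') [IsProbabilityMeasure μK] [μK.IsMulLeftInvariant] [μK.IsMulRightInvariant] [μK.IsInvInvariant]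
    (hα : ∀ (ψ : (quasiSplit (↥(maximalRealSubfield L)) L (IsCMField.complexConj L) 2).Adelic → ℂ), Continuous ψ →
      (∀ (u : adelicUnipotent (↥(maximalRealSubfield L)) L (IsCMField.complexConj L) 2) (g : (quasiSplit (↥(maximalRealSubfield L)) L (IsCMField.complexConj L) 2).Adelic),
        ψ ((u : (quasiSplit (↥(maximalRealSubfield L)) L (IsCMField.complexConj L) 2).Adelic) * g) = ψ g) →
      (∀ b ∈ arithmeticBorel (↥(maximalRealSubfield L)) L (IsCMField.complexConj L) 2, ∀ g, ψ ((b : (quasiSplit (↥(maximalRealSubfield L)) L (IsCMField.complexConj L) 2).Adelic) * g) = ψ g) →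
      (∀ (g : (quasiSplit (↥(maximalRealSubfield L)) L (IsCMField.complexConj L) 2).Adelic) (k : K'), ψ (g * (k : (quasiSplit (↥(maximalRealSubfield L)) L (IsCMField.complexConj L) 2).Adelic)) = ψ g) →
      ∀ {a b : ℝ≥0}, 0 < a → (∀ g, ψ g ≠ 0 → a ≤ borelHeight g ∧ borelHeight g ≤ b) → ∀ ε : ℝ, 0 < ε →
        ∃ (s : Finset (HeckeCharacter L)) (coef : HeckeCharacter L → ℂ) (P : HeckeCharacter L → (quasiSplit (↥(maximalRealSubfield L)) L (IsCMField.complexConj L) 2).Adelic → ℂ),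
          (∀ χ ∈ s, (∀ r : ℝ≥0ˣ, χ (posRealIdele L r) = 1) ∧ Continuous (P χ) ∧
            (∀ (g : (quasiSplit (↥(maximalRealSubfield L)) L (IsCMField.complexConj L) 2).Adelic) (k : K'), P χ (g * (k : (quasiSplit (↥(maximalRealSubfield L)) L (IsCMField.complexConj L) 2).Adelic)) = P χ g) ∧
            (∀ b ∈ arithmeticBorel (↥(maximalRealSubfield L)) L (IsCMField.complexConj L) 2, ∀ g, P χ ((b : (quasiSplit (↥(maximalRealSubfield L)) L (IsCMField.complexConj L) 2).Adelic) * g) = P χ g) ∧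
            (∀ (b : (quasiSplit (↥(maximalRealSubfield L)) L (IsCMField.complexConj L) 2).Adelic) (hb : b ∈ borelAdelic (↥(maximalRealSubfield L)) L (IsCMField.complexConj L) 2),
              IdeleClassGroup.ideleNorm L (firstEntryUnit hb) = 1 → ∀ g, P χ (b * g) = ((χ (firstEntryUnit hb) : ℂˣ) : ℂ) * P χ g) ∧
            (∀ g, P χ g ≠ 0 → a ≤ borelHeight g ∧ borelHeight g ≤ b) ∧ (∃ M : ℝ, ∀ g, ‖P χ g‖ ≤ M)) ∧
          ∀ g, ‖ψ g - ∑ χ ∈ s, coef χ * P χ g‖ ≤ ε) :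
    ((quasiSplit (↥(maximalRealSubfield L)) L (IsCMField.complexConj L) 2).cuspidalSubspace μ 𝔓).toSubmoduleᗮ ⊓
          (((quasiSplit (↥(maximalRealSubfield L)) L (IsCMField.complexConj L) 2).rightRegular μ).restrict K'.subtype).invariants ≤
      (⨆ χ ∈ {χ : HeckeCharacter L | (∀ r : ℝ≥0ˣ, χ (posRealIdele L r) = 1) ∧ ∃ w ∈ W, ∀ u ∈ ((K'.map (MulAut.conj w).toMonoidHom).comap ((borelAdelic (↥(maximalRealSubfield L)) L (IsCMField.complexConj L) 2).subtype.comp (torusInBorel (↥(maximalRealSubfield L)) L (IsCMField.complexConj L) 2).subtype)).map (MonoidHom.mk' (fun t : torusInBorel (↥(maximalRealSubfield L)) L (IsCMField.complexConj L) 2 => diagUnit (t : borelAdelic (↥(maximalRealSubfield L)) L (IsCMField.complexConj L) 2).2 0) (fun t t' => diagUnit_torus_mul_two t t' 0)), χ u = 1}, Submodule.span ℂ {v : (quasiSplit (↥(maximalRealSubfield L)) L (IsCMField.complexConj L) 2).L2 μ |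
        ∃ (f : ℝ → ℂ) (_ : Continuous f) (_ : HasCompactSupport f) (_ : tsupport f ⊆ Ioi 0)
          (φ : (quasiSplit (↥(maximalRealSubfield L)) L (IsCMField.complexConj L) 2).Adelic → ℂ) (_ : φ ∈ chiSectionSpace χ K' 1) (_ : Continuous φ)
          (hv : MemLp ((quasiSplit (↥(maximalRealSubfield L)) L (IsCMField.complexConj L) 2).quotFun (eisensteinSeriesU (fun g => f (borelHeight g) * φ g))) 2 μ), v = hv.toLp _}).topologicalClosure := by
  classical
  have hBK : ∃ W : Finset (quasiSplit (↥(maximalRealSubfield L)) L (IsCMField.complexConj L) 2).Adelic, ∀ g, ∃ β ∈ borelAdelic (↥(maximalRealSubfield L)) L (IsCMField.complexConj L) 2, ∃ w ∈ W, ∃ k ∈ K', g = β * w * k := ⟨W, hW⟩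
  have hδ : ∀ (u : (quasiSplit (↥(maximalRealSubfield L)) L (IsCMField.complexConj L) 2).Adelic → ℂ), Continuous u →
      (∀ b ∈ arithmeticBorel (↥(maximalRealSubfield L)) L (IsCMField.complexConj L) 2, ∀ x, u ((b : (quasiSplit (↥(maximalRealSubfield L)) L (IsCMField.complexConj L) 2).Adelic) * x) = u x) →
      (∃ M : ℝ, ∀ g, ‖u g‖ ≤ M) → ∀ {a b : ℝ≥0}, 0 < a → (∀ g, u g ≠ 0 → a ≤ borelHeight g ∧ borelHeight g ≤ b) →
        MemLp ((quasiSplit (↥(maximalRealSubfield L)) L (IsCMField.complexConj L) 2).quotFun (eisensteinSeriesU u)) 2 μ := fun u huc huB hM _ _ ha hband => by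
    obtain ⟨M, huM⟩ := hM
    exact memLp_quotFun_eisensteinSeriesU_of_nice L μ 2 huc huB huM ha hband
  -- structural instances of the CM quasi-split datum
  haveI := t2Space_adeleRing_of_numberField L
  haveI := locallyCompactSpace_adeleRing' L
  haveI := secondCountableTopology_adeleRing L
  haveI : LocallyCompactSpace (quasiSplit (↥(maximalRealSubfield L)) L (IsCMField.complexConj L) 2).Adelic :=
    inferInstanceAs (LocallyCompactSpace (adelic (↥(maximalRealSubfield L)) L (IsCMField.complexConj L) 2 ((StdForm.antidiagonal 2).over L)))
  haveI : SecondCountableTopology (quasiSplit (↥(maximalRealSubfield L)) L (IsCMField.complexConj L) 2).Adelic :=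
    inferInstanceAs (SecondCountableTopology (adelic (↥(maximalRealSubfield L)) L (IsCMField.complexConj L) 2 ((StdForm.antidiagonal 2).over L)))
  haveI : T2Space (quasiSplit (↥(maximalRealSubfield L)) L (IsCMField.complexConj L) 2).Adelic :=
    inferInstanceAs (T2Space (adelic (↥(maximalRealSubfield L)) L (IsCMField.complexConj L) 2 ((StdForm.antidiagonal 2).over L)))
  haveI : DiscreteTopology (quasiSplit (↥(maximalRealSubfield L)) L (IsCMField.complexConj L) 2).quotientSubgroup := by
    rw [quotientSubgroup_quasiSplit]; exact isDiscreteRational_quasiSplit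
  haveI : CompactSpace ↥K' := isCompact_iff_compactSpace.1 hK'c
  -- ★ P1b: the nice `K′`-invariant generators
  have hN : ∀ i : 𝔓.ι, IsClosed ((𝔓.radical i : Subgroup (quasiSplit (↥(maximalRealSubfield L)) L (IsCMField.complexConj L) 2).Adelic) :
      Set (quasiSplit (↥(maximalRealSubfield L)) L (IsCMField.complexConj L) 2).Adelic) := fun i => by rw [h𝔓 i]; exact isClosed_adelicUnipotent_quasiSplit_cm L
  have hP1 := orthogonal_inf_invariants_eq_topologicalClosure_span_nice (quasiSplit (↥(maximalRealSubfield L)) L (IsCMField.complexConj L) 2) 𝔓 μ ν μK K'.subtype hN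
    continuous_subtype_val ((quasiSplit (↥(maximalRealSubfield L)) L (IsCMField.complexConj L) 2).cuspidalSubspace μ 𝔓) rfl rfl rfl (orthogonal_eq_topologicalClosure_span_of_borel L 𝔓 hne h𝔓 μ)
  rw [hP1]
  refine Submodule.topologicalClosure_minimal _ (Submodule.span_le.2 ?_) (Submodule.isClosed_topologicalClosure _)
  rintro v ⟨i, Φ, hΦm, hΦ, h2, hΦc, ⟨M, hM⟩, ⟨C, hC, hCΦ⟩, hK, hθ, rfl⟩
  show hθ.toLp _ ∈ ((_ : Submodule ℂ ((quasiSplit (↥(maximalRealSubfield L)) L (IsCMField.complexConj L) 2).L2 μ)).topologicalClosure : Set _)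
  rw [Submodule.topologicalClosure_coe, Metric.mem_closure_iff]
  intro ε hε
  -- `Φ` in the Borel currency; `ψ = (Φ_B)^∨` and its niceness (★ F3b, ★ F3b′)
  have hΦ' : ∀ (g : (quasiSplit (↥(maximalRealSubfield L)) L (IsCMField.complexConj L) 2).Adelic) (u : adelicUnipotent (↥(maximalRealSubfield L)) L (IsCMField.complexConj L) 2), Φ (g * u) = Φ g :=
    fun g u => hΦ g ⟨u, by rw [h𝔓 i]; exact u.2⟩
  have hCΦ' : ∀ g, g ∉ C * ((adelicUnipotent (↥(maximalRealSubfield L)) L (IsCMField.complexConj L) 2 : Subgroup _) : Set _) → Φ g = 0 := fun g hg => hCΦ g (by rwa [h𝔓 i])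
  set ψ : (quasiSplit (↥(maximalRealSubfield L)) L (IsCMField.complexConj L) 2).Adelic → ℂ := fun h =>
    ∑' q : ↥(arithmeticBorel (↥(maximalRealSubfield L)) L (IsCMField.complexConj L) 2) ⧸
        ((adelicUnipotent (↥(maximalRealSubfield L)) L (IsCMField.complexConj L) 2).subgroupOf (quasiSplit (↥(maximalRealSubfield L)) L (IsCMField.complexConj L) 2).arithmeticSubgroup).subgroupOf
          (arithmeticBorel (↥(maximalRealSubfield L)) L (IsCMField.complexConj L) 2),
      Φ (h⁻¹ * (((q.out : arithmeticBorel (↥(maximalRealSubfield L)) L (IsCMField.complexConj L) 2) : (quasiSplit (↥(maximalRealSubfield L)) L (IsCMField.complexConj L) 2).arithmeticSubgroup) :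
        (quasiSplit (↥(maximalRealSubfield L)) L (IsCMField.complexConj L) 2).Adelic)) with hψdef
  have hψc : Continuous ψ := continuous_inv_periodization hΦc hC hCΦ'
  have hψU : ∀ (u : adelicUnipotent (↥(maximalRealSubfield L)) L (IsCMField.complexConj L) 2) (g : (quasiSplit (↥(maximalRealSubfield L)) L (IsCMField.complexConj L) 2).Adelic),
      ψ ((u : (quasiSplit (↥(maximalRealSubfield L)) L (IsCMField.complexConj L) 2).Adelic) * g) = ψ g := fun u g => inv_periodization_unipotent_mul hΦ' u g
  have hψB : ∀ b ∈ arithmeticBorel (↥(maximalRealSubfield L)) L (IsCMField.complexConj L) 2, ∀ g,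
      ψ ((b : (quasiSplit (↥(maximalRealSubfield L)) L (IsCMField.complexConj L) 2).Adelic) * g) = ψ g := inv_periodization_borel_mul hΦ'
  have hψK : ∀ (g : (quasiSplit (↥(maximalRealSubfield L)) L (IsCMField.complexConj L) 2).Adelic) (k : K'),
      ψ (g * (k : (quasiSplit (↥(maximalRealSubfield L)) L (IsCMField.complexConj L) 2).Adelic)) = ψ g := fun g k => inv_periodization_mul_right K'.subtype hK g k
  obtain ⟨a, b, ha, hband⟩ := exists_band_of_inv_periodization_ne_zero (Φ := Φ) hC hCΦ'
  obtain ⟨Mψ, hMψ⟩ := exists_bound_inv_periodization hΦc hΦ' hC hCΦ'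
  have hvψ : MemLp ((quasiSplit (↥(maximalRealSubfield L)) L (IsCMField.complexConj L) 2).quotFun (eisensteinSeriesU ψ)) 2 μ := hδ ψ hψc hψB ⟨Mψ, hMψ⟩ ha hband
  have hvθ : hθ.toLp _ = hvψ.toLp _ := toLp_pseudoEisenstein_eq_toLp_quotFun_eisensteinSeriesU 𝔓 i (h𝔓 i) μ hΦm hΦ h2
  -- ★ F3d-γ's constant at threshold `a/2`
  have ha2 : (0 : ℝ≥0) < a / 2 := half_pos ha
  obtain ⟨Cγ, hCγ0, hCγ⟩ := exists_const_norm_toLp_sub_sum_le_cm L μ ha2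
  set Kc : ℝ := (measureUnivNNReal μ : ℝ) ^ (2 : ℝ)⁻¹ * Cγ with hKc
  have hKc0 : 0 ≤ Kc := mul_nonneg (Real.rpow_nonneg (NNReal.coe_nonneg _) _) hCγ0
  -- the approximation from `hα` at `ε' = ε / (Kc + 1)`
  have hε' : 0 < ε / (Kc + 1) := div_pos hε (by linarith)
  obtain ⟨s, coef, P, hP, happrox⟩ := hα ψ hψc hψU hψB hψK ha hband (ε / (Kc + 1)) hε'
  -- `L²` classes of the `P_χ`, `χ ∈ s`
  have hvP : ∀ j : ↥s, MemLp ((quasiSplit (↥(maximalRealSubfield L)) L (IsCMField.complexConj L) 2).quotFun (eisensteinSeriesU (P (j : HeckeCharacter L)))) 2 μ := fun j =>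
    hδ (P j) (hP j j.2).2.1 (hP j j.2).2.2.2.1 (hP j j.2).2.2.2.2.2.2 ha (hP j j.2).2.2.2.2.2.1
  -- the approximant and its membership in `⨆_χ span(gen χ)`
  set y : (quasiSplit (↥(maximalRealSubfield L)) L (IsCMField.complexConj L) 2).L2 μ := ∑ j : ↥s, coef (j : HeckeCharacter L) • (hvP j).toLp _ with hy
  have hyV : y ∈ (⨆ χ ∈ {χ : HeckeCharacter L | (∀ r : ℝ≥0ˣ, χ (posRealIdele L r) = 1) ∧ ∃ w ∈ W, ∀ u ∈ ((K'.map (MulAut.conj w).toMonoidHom).comap ((borelAdelic (↥(maximalRealSubfield L)) L (IsCMField.complexConj L) 2).subtype.comp (torusInBorel (↥(maximalRealSubfield L)) L (IsCMField.complexConj L) 2).subtype)).map (MonoidHom.mk' (fun t : torusInBorel (↥(maximalRealSubfield L)) L (IsCMField.complexConj L) 2 => diagUnit (t : borelAdelic (↥(maximalRealSubfield L)) L (IsCMField.complexConj L) 2).2 0) (fun t t' => diagUnit_torus_mul_two t t' 0)), χ u = 1},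
      Submodule.span ℂ {v : (quasiSplit (↥(maximalRealSubfield L)) L (IsCMField.complexConj L) 2).L2 μ |
        ∃ (f : ℝ → ℂ) (_ : Continuous f) (_ : HasCompactSupport f) (_ : tsupport f ⊆ Ioi 0)
          (φ : (quasiSplit (↥(maximalRealSubfield L)) L (IsCMField.complexConj L) 2).Adelic → ℂ) (_ : φ ∈ chiSectionSpace χ K' 1) (_ : Continuous φ)
          (hv : MemLp ((quasiSplit (↥(maximalRealSubfield L)) L (IsCMField.complexConj L) 2).quotFun (eisensteinSeriesU (fun g => f (borelHeight g) * φ g))) 2 μ), v = hv.toLp _}) := by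
    refine Submodule.sum_mem _ fun j _ => ?_
    obtain ⟨hχray, hPc, hPK, hPB, hPχ, hPband, hPM⟩ := hP j j.2
    by_cases hP0 : ∀ g, P (j : HeckeCharacter L) g = 0
    · -- the class of `E 0` is `0`
      have hz : (hvP j).toLp _ = 0 := by
        have hfun : ∀ x : (quasiSplit (↥(maximalRealSubfield L)) L (IsCMField.complexConj L) 2).automorphicQuotient,
            (quasiSplit (↥(maximalRealSubfield L)) L (IsCMField.complexConj L) 2).quotFun (eisensteinSeriesU (P (j : HeckeCharacter L))) x =
              (0 : (quasiSplit (↥(maximalRealSubfield L)) L (IsCMField.complexConj L) 2).automorphicQuotient → ℂ) x := fun x => by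
          simp only [AdelicGroupData.quotFun, Pi.zero_apply, eisensteinSeriesU_def, hP0, tsum_zero]
        exact (MemLp.toLp_congr (hvP j) (MemLp.zero (ε := ℂ)) (Eventually.of_forall hfun)).trans (MemLp.toLp_zero _)
      rw [hz, smul_zero]; exact Submodule.zero_mem _
    · obtain ⟨g, hg⟩ := not_forall.1 hP0
      obtain ⟨β, hβ, w, hw, k, hk, rfl⟩ := hW g
      have hne : P (j : HeckeCharacter L) (β * w) ≠ 0 := by rwa [hPK _ ⟨k, hk⟩] at hg
      have hlevel : ∀ u ∈ ((K'.map (MulAut.conj w).toMonoidHom).comap ((borelAdelic (↥(maximalRealSubfield L)) L (IsCMField.complexConj L) 2).subtype.comp (torusInBorel (↥(maximalRealSubfield L)) L (IsCMField.complexConj L) 2).subtype)).map (MonoidHom.mk' (fun t : torusInBorel (↥(maximalRealSubfield L)) L (IsCMField.complexConj L) 2 => diagUnit (t : borelAdelic (↥(maximalRealSubfield L)) L (IsCMField.complexConj L) 2).2 0) (fun t t' => diagUnit_torus_mul_two t t' 0)), (j : HeckeCharacter L) u = 1 := by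
        intro u hu
        obtain ⟨t, ht, rfl⟩ := Subgroup.mem_map.1 hu
        obtain ⟨k', hk', hkt⟩ := Subgroup.mem_map.1 (Subgroup.mem_comap.1 ht)
        have h : (((t : torusInBorel (↥(maximalRealSubfield L)) L (IsCMField.complexConj L) 2) : borelAdelic (↥(maximalRealSubfield L)) L (IsCMField.complexConj L) 2) :
            (quasiSplit (↥(maximalRealSubfield L)) L (IsCMField.complexConj L) 2).Adelic) * w = w * k' := by
          have h' : w * k' * w⁻¹ = (((t : torusInBorel (↥(maximalRealSubfield L)) L (IsCMField.complexConj L) 2) : borelAdelic (↥(maximalRealSubfield L)) L (IsCMField.complexConj L) 2) :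
            (quasiSplit (↥(maximalRealSubfield L)) L (IsCMField.complexConj L) 2).Adelic) := hkt
          rw [← h', inv_mul_cancel_right]
        have h1 := chi_firstEntryUnit_eq_one_of_apply_ne_zero hHK' (j : HeckeCharacter L) (fun g k hk => hPK g ⟨k, hk⟩) hPχ hβ hne
          ((t : borelAdelic (↥(maximalRealSubfield L)) L (IsCMField.complexConj L) 2)).2 hk' h
        rw [firstEntryUnit_eq_diagUnit_zero] at h1
        exact Units.val_eq_one.1 h1
      refine Submodule.smul_mem _ _ (Submodule.mem_iSup_of_mem (j : HeckeCharacter L) (Submodule.mem_iSup_of_mem ⟨hχray, w, hw, hlevel⟩ ?_))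
      exact toLp_quotFun_eisensteinSeriesU_mem_span_family μ hc hK'o hHK' hBK hδ (j : HeckeCharacter L) hχray hPc (fun g k hk => hPK g ⟨k, hk⟩) hPB hPχ hPM ha hPband (hvP j)
  refine ⟨y, hyV, ?_⟩
  -- the distance estimate (★ F3d-γ)
  have hψa : ∀ g, borelHeight g ≤ a / 2 → ψ g = 0 := fun g hg => by
    by_contra hne; exact absurd ((hband g hne).1.trans hg) (not_le.2 (half_lt_self ha))
  have hPa : ∀ (j : ↥s) g, borelHeight g ≤ a / 2 → P (j : HeckeCharacter L) g = 0 := fun j g hg => by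
    by_contra hne; exact absurd (((hP j j.2).2.2.2.2.2.1 g hne).1.trans hg) (not_le.2 (half_lt_self ha))
  have happrox' : ∀ g, ‖ψ g - ∑ j ∈ (Finset.univ : Finset ↥s), coef (j : HeckeCharacter L) * P (j : HeckeCharacter L) g‖ ≤ ε / (Kc + 1) := fun g => by
    rw [Finset.sum_coe_sort s (fun χ => coef χ * P χ g)]; exact happrox g
  have hdist := hCγ (Finset.univ : Finset ↥s) (fun j => coef (j : HeckeCharacter L)) ψ (fun j => P (j : HeckeCharacter L)) hψB (fun j => (hP j j.2).2.2.2.1) hψa hPa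
    (ε / (Kc + 1)) happrox' hvψ hvP
  rw [dist_eq_norm, hvθ, hy]
  calc ‖hvψ.toLp _ - ∑ j : ↥s, coef (j : HeckeCharacter L) • (hvP j).toLp _‖ ≤ (measureUnivNNReal μ : ℝ) ^ (2 : ℝ)⁻¹ * Cγ * (ε / (Kc + 1)) := hdist
    _ = Kc * (ε / (Kc + 1)) := by rw [hKc]
    _ < ε := by
        rw [mul_div_assoc', div_lt_iff₀ (by linarith)]
        nlinarith



/-! ## §2 LETTER-FREE NAMED PRINTS -/

/-- **C7 NAMED, ALL FAMILIES, LETTER-FREE**: for EVERY Borel datum `𝔓` (`Nonempty 𝔓.ι`, radicals `= N(𝔸)`), `(cusp μ 𝔓)ᗮ ∩ L²(X)^{K′} ≤ closure ⨆_χ span(pure-tensor classes)`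
(★ HEAD + ★∕📤 ∀-guarded bridge + ★ F3d-α + ★ F3d-δ). [cite: MoeglinWaldspurger1995, II.1.1–II.1.4, II.2.4] [cite: BernsteinLapid2019, §4] -/
theorem cuspidal_orthogonal_inf_invariants_le_topologicalClosure_iSup_family_named_of_bricks (hc : IsCMField.complexConj L * IsCMField.complexConj L = 1)
    [MeasurableSpace (quasiSplit (↥(maximalRealSubfield L)) L (IsCMField.complexConj L) 2).Adelic] [BorelSpace (quasiSplit (↥(maximalRealSubfield L)) L (IsCMField.complexConj L) 2).Adelic]
    [(quasiSplit (↥(maximalRealSubfield L)) L (IsCMField.complexConj L) 2).IsAutomorphicMeasure μ]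
    (ν : Measure (quasiSplit (↥(maximalRealSubfield L)) L (IsCMField.complexConj L) 2).Adelic) [ν.IsHaarMeasure]
    (𝔓 : (quasiSplit (↥(maximalRealSubfield L)) L (IsCMField.complexConj L) 2).ParabolicUnipotentData) (hne : Nonempty 𝔓.ι) (h𝔓 : ∀ i : 𝔓.ι, 𝔓.radical i = adelicUnipotent (↥(maximalRealSubfield L)) L (IsCMField.complexConj L) 2)
    (K' : Subgroup (quasiSplit (↥(maximalRealSubfield L)) L (IsCMField.complexConj L) 2).Adelic) (hK'o : IsOpen (K' : Set (quasiSplit (↥(maximalRealSubfield L)) L (IsCMField.complexConj L) 2).Adelic))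
    (hK'c : IsCompact (K' : Set (quasiSplit (↥(maximalRealSubfield L)) L (IsCMField.complexConj L) 2).Adelic))
    (hHK' : ∀ (g k : (quasiSplit (↥(maximalRealSubfield L)) L (IsCMField.complexConj L) 2).Adelic), k ∈ K' → borelHeight (g * k) = borelHeight g)
    (hBK : ∃ W : Finset (quasiSplit (↥(maximalRealSubfield L)) L (IsCMField.complexConj L) 2).Adelic, ∀ g, ∃ β ∈ borelAdelic (↥(maximalRealSubfield L)) L (IsCMField.complexConj L) 2, ∃ w ∈ W, ∃ k ∈ K', g = β * w * k)
    (μK : Measure ↥K') [IsProbabilityMeasure μK] [μK.IsMulLeftInvariant] [μK.IsMulRightInvariant] [μK.IsInvInvariant] :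
    ((quasiSplit (↥(maximalRealSubfield L)) L (IsCMField.complexConj L) 2).cuspidalSubspace μ 𝔓).toSubmoduleᗮ ⊓
          (((quasiSplit (↥(maximalRealSubfield L)) L (IsCMField.complexConj L) 2).rightRegular μ).restrict K'.subtype).invariants ≤
      (⨆ χ : HeckeCharacter L, Submodule.span ℂ {v : (quasiSplit (↥(maximalRealSubfield L)) L (IsCMField.complexConj L) 2).L2 μ |
        ∃ (f : ℝ → ℂ) (_ : Continuous f) (_ : HasCompactSupport f) (_ : tsupport f ⊆ Ioi 0)
          (φ : (quasiSplit (↥(maximalRealSubfield L)) L (IsCMField.complexConj L) 2).Adelic → ℂ) (_ : φ ∈ chiSectionSpace χ K' 1) (_ : Continuous φ)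
          (hv : MemLp ((quasiSplit (↥(maximalRealSubfield L)) L (IsCMField.complexConj L) 2).quotFun (eisensteinSeriesU (fun g => f (borelHeight g) * φ g))) 2 μ), v = hv.toLp _}).topologicalClosure :=
  orthogonal_inf_invariants_le_topologicalClosure_iSup_family μ hc ν 𝔓 h𝔓 K' hK'o hK'c hHK' hBK μK ((quasiSplit (↥(maximalRealSubfield L)) L (IsCMField.complexConj L) 2).cuspidalSubspace μ 𝔓) rfl
    (orthogonal_eq_topologicalClosure_span_of_borel L 𝔓 hne h𝔓 μ)
    (@fun ψ hψc hψU hψB hψK _ _ ha hband ε hε => exists_finset_heckeCharacter_family_decomposition hc hBK ψ hψc hψU hψB hψK ha hband ε hε)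
    (fun u huc huB hM _ _ ha hband => by
      obtain ⟨M, huM⟩ := hM
      exact memLp_quotFun_eisensteinSeriesU_of_nice L μ 2 huc huB huM ha hband)

/-- **C7 NAMED, FINITE INDEX `S(K′)`, LETTER-FREE** (§1 with `hα :=` ★ F3d-α). [cite: MoeglinWaldspurger1995, II.1.1–II.1.4, II.2.4] -/
theorem cuspidal_orthogonal_inf_invariants_le_topologicalClosure_biSup_levelFamilies_named_of_bricks (hc : IsCMField.complexConj L * IsCMField.complexConj L = 1)
    [MeasurableSpace (quasiSplit (↥(maximalRealSubfield L)) L (IsCMField.complexConj L) 2).Adelic] [BorelSpace (quasiSplit (↥(maximalRealSubfield L)) L (IsCMField.complexConj L) 2).Adelic]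
    [(quasiSplit (↥(maximalRealSubfield L)) L (IsCMField.complexConj L) 2).IsAutomorphicMeasure μ]
    (ν : Measure (quasiSplit (↥(maximalRealSubfield L)) L (IsCMField.complexConj L) 2).Adelic) [ν.IsHaarMeasure]
    (𝔓 : (quasiSplit (↥(maximalRealSubfield L)) L (IsCMField.complexConj L) 2).ParabolicUnipotentData) (hne : Nonempty 𝔓.ι) (h𝔓 : ∀ i : 𝔓.ι, 𝔓.radical i = adelicUnipotent (↥(maximalRealSubfield L)) L (IsCMField.complexConj L) 2)
    (K' : Subgroup (quasiSplit (↥(maximalRealSubfield L)) L (IsCMField.complexConj L) 2).Adelic) (hK'o : IsOpen (K' : Set (quasiSplit (↥(maximalRealSubfield L)) L (IsCMField.complexConj L) 2).Adelic))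
    (hK'c : IsCompact (K' : Set (quasiSplit (↥(maximalRealSubfield L)) L (IsCMField.complexConj L) 2).Adelic))
    (hHK' : ∀ (g k : (quasiSplit (↥(maximalRealSubfield L)) L (IsCMField.complexConj L) 2).Adelic), k ∈ K' → borelHeight (g * k) = borelHeight g)
    (W : Finset (quasiSplit (↥(maximalRealSubfield L)) L (IsCMField.complexConj L) 2).Adelic) (hW : ∀ g, ∃ β ∈ borelAdelic (↥(maximalRealSubfield L)) L (IsCMField.complexConj L) 2, ∃ w ∈ W, ∃ k ∈ K', g = β * w * k)
    (μK : Measure ↥K') [IsProbabilityMeasure μK] [μK.IsMulLeftInvariant] [μK.IsMulRightInvariant] [μK.IsInvInvariant] :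
    ((quasiSplit (↥(maximalRealSubfield L)) L (IsCMField.complexConj L) 2).cuspidalSubspace μ 𝔓).toSubmoduleᗮ ⊓
          (((quasiSplit (↥(maximalRealSubfield L)) L (IsCMField.complexConj L) 2).rightRegular μ).restrict K'.subtype).invariants ≤
      (⨆ χ ∈ {χ : HeckeCharacter L | (∀ r : ℝ≥0ˣ, χ (posRealIdele L r) = 1) ∧ ∃ w ∈ W, ∀ u ∈ ((K'.map (MulAut.conj w).toMonoidHom).comap ((borelAdelic (↥(maximalRealSubfield L)) L (IsCMField.complexConj L) 2).subtype.comp (torusInBorel (↥(maximalRealSubfield L)) L (IsCMField.complexConj L) 2).subtype)).map (MonoidHom.mk' (fun t : torusInBorel (↥(maximalRealSubfield L)) L (IsCMField.complexConj L) 2 => diagUnit (t : borelAdelic (↥(maximalRealSubfield L)) L (IsCMField.complexConj L) 2).2 0) (fun t t' => diagUnit_torus_mul_two t t' 0)), χ u = 1}, Submodule.span ℂ {v : (quasiSplit (↥(maximalRealSubfield L)) L (IsCMField.complexConj L) 2).L2 μ |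
        ∃ (f : ℝ → ℂ) (_ : Continuous f) (_ : HasCompactSupport f) (_ : tsupport f ⊆ Ioi 0)
          (φ : (quasiSplit (↥(maximalRealSubfield L)) L (IsCMField.complexConj L) 2).Adelic → ℂ) (_ : φ ∈ chiSectionSpace χ K' 1) (_ : Continuous φ)
          (hv : MemLp ((quasiSplit (↥(maximalRealSubfield L)) L (IsCMField.complexConj L) 2).quotFun (eisensteinSeriesU (fun g => f (borelHeight g) * φ g))) 2 μ), v = hv.toLp _}).topologicalClosure :=
  cuspidal_orthogonal_inf_invariants_le_topologicalClosure_biSup_levelFamilies_named L μ hc 𝔓 hne h𝔓 ν K' hK'o hK'c hHK' W hW μK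
    (@fun ψ hψc hψU hψB hψK _ _ ha hband ε hε => exists_finset_heckeCharacter_family_decomposition hc ⟨W, hW⟩ ψ hψc hψU hψB hψK ha hband ε hε)

/-- **THE NAMED C7 EXHAUSTION IN BLOCK CURRENCY** (for ★ `hEXH_of_orthogonalBlocks`): for EVERY Borel datum `𝔓` (`Nonempty 𝔓.ι`, radicals `= N(𝔸)`), `S(K′)` is finite, the blocks
`Blk b = closure span(gen b)` are complete, and `Eis(𝔓) := (cusp μ 𝔓)ᗮ ⊓ L²(X)^{K′} ≤ closure ⨆_{b : ↥S(K′)} Blk b`. [cite: MoeglinWaldspurger1995, II.2.4] [cite: ReedSimonI1980, Thm. II.3] -/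
theorem finite_blocks_named (hc : IsCMField.complexConj L * IsCMField.complexConj L = 1)
    [MeasurableSpace (quasiSplit (↥(maximalRealSubfield L)) L (IsCMField.complexConj L) 2).Adelic] [BorelSpace (quasiSplit (↥(maximalRealSubfield L)) L (IsCMField.complexConj L) 2).Adelic]
    [(quasiSplit (↥(maximalRealSubfield L)) L (IsCMField.complexConj L) 2).IsAutomorphicMeasure μ]
    (ν : Measure (quasiSplit (↥(maximalRealSubfield L)) L (IsCMField.complexConj L) 2).Adelic) [ν.IsHaarMeasure]
    (𝔓 : (quasiSplit (↥(maximalRealSubfield L)) L (IsCMField.complexConj L) 2).ParabolicUnipotentData) (hne : Nonempty 𝔓.ι) (h𝔓 : ∀ i : 𝔓.ι, 𝔓.radical i = adelicUnipotent (↥(maximalRealSubfield L)) L (IsCMField.complexConj L) 2)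
    (K' : Subgroup (quasiSplit (↥(maximalRealSubfield L)) L (IsCMField.complexConj L) 2).Adelic) (hK'o : IsOpen (K' : Set (quasiSplit (↥(maximalRealSubfield L)) L (IsCMField.complexConj L) 2).Adelic))
    (hK'c : IsCompact (K' : Set (quasiSplit (↥(maximalRealSubfield L)) L (IsCMField.complexConj L) 2).Adelic))
    (hHK' : ∀ (g k : (quasiSplit (↥(maximalRealSubfield L)) L (IsCMField.complexConj L) 2).Adelic), k ∈ K' → borelHeight (g * k) = borelHeight g)
    (W : Finset (quasiSplit (↥(maximalRealSubfield L)) L (IsCMField.complexConj L) 2).Adelic) (hW : ∀ g, ∃ β ∈ borelAdelic (↥(maximalRealSubfield L)) L (IsCMField.complexConj L) 2, ∃ w ∈ W, ∃ k ∈ K', g = β * w * k)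
    (μK : Measure ↥K') [IsProbabilityMeasure μK] [μK.IsMulLeftInvariant] [μK.IsMulRightInvariant] [μK.IsInvInvariant] :
    Set.Finite {χ : HeckeCharacter L | (∀ r : ℝ≥0ˣ, χ (posRealIdele L r) = 1) ∧ ∃ w ∈ W, ∀ u ∈ ((K'.map (MulAut.conj w).toMonoidHom).comap ((borelAdelic (↥(maximalRealSubfield L)) L (IsCMField.complexConj L) 2).subtype.comp (torusInBorel (↥(maximalRealSubfield L)) L (IsCMField.complexConj L) 2).subtype)).map (MonoidHom.mk' (fun t : torusInBorel (↥(maximalRealSubfield L)) L (IsCMField.complexConj L) 2 => diagUnit (t : borelAdelic (↥(maximalRealSubfield L)) L (IsCMField.complexConj L) 2).2 0) (fun t t' => diagUnit_torus_mul_two t t' 0)), χ u = 1} ∧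
      (∀ b : ↥{χ : HeckeCharacter L | (∀ r : ℝ≥0ˣ, χ (posRealIdele L r) = 1) ∧ ∃ w ∈ W, ∀ u ∈ ((K'.map (MulAut.conj w).toMonoidHom).comap ((borelAdelic (↥(maximalRealSubfield L)) L (IsCMField.complexConj L) 2).subtype.comp (torusInBorel (↥(maximalRealSubfield L)) L (IsCMField.complexConj L) 2).subtype)).map (MonoidHom.mk' (fun t : torusInBorel (↥(maximalRealSubfield L)) L (IsCMField.complexConj L) 2 => diagUnit (t : borelAdelic (↥(maximalRealSubfield L)) L (IsCMField.complexConj L) 2).2 0) (fun t t' => diagUnit_torus_mul_two t t' 0)), χ u = 1},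
        CompleteSpace ↥(Submodule.span ℂ {v : (quasiSplit (↥(maximalRealSubfield L)) L (IsCMField.complexConj L) 2).L2 μ |
        ∃ (f : ℝ → ℂ) (_ : Continuous f) (_ : HasCompactSupport f) (_ : tsupport f ⊆ Ioi 0)
          (φ : (quasiSplit (↥(maximalRealSubfield L)) L (IsCMField.complexConj L) 2).Adelic → ℂ) (_ : φ ∈ chiSectionSpace (b : HeckeCharacter L) K' 1) (_ : Continuous φ)
          (hv : MemLp ((quasiSplit (↥(maximalRealSubfield L)) L (IsCMField.complexConj L) 2).quotFun (eisensteinSeriesU (fun g => f (borelHeight g) * φ g))) 2 μ), v = hv.toLp _}).topologicalClosure) ∧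
      ((quasiSplit (↥(maximalRealSubfield L)) L (IsCMField.complexConj L) 2).cuspidalSubspace μ 𝔓).toSubmoduleᗮ ⊓
          (((quasiSplit (↥(maximalRealSubfield L)) L (IsCMField.complexConj L) 2).rightRegular μ).restrict K'.subtype).invariants ≤
      (⨆ b : ↥{χ : HeckeCharacter L | (∀ r : ℝ≥0ˣ, χ (posRealIdele L r) = 1) ∧ ∃ w ∈ W, ∀ u ∈ ((K'.map (MulAut.conj w).toMonoidHom).comap ((borelAdelic (↥(maximalRealSubfield L)) L (IsCMField.complexConj L) 2).subtype.comp (torusInBorel (↥(maximalRealSubfield L)) L (IsCMField.complexConj L) 2).subtype)).map (MonoidHom.mk' (fun t : torusInBorel (↥(maximalRealSubfield L)) L (IsCMField.complexConj L) 2 => diagUnit (t : borelAdelic (↥(maximalRealSubfield L)) L (IsCMField.complexConj L) 2).2 0) (fun t t' => diagUnit_torus_mul_two t t' 0)), χ u = 1},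
        (Submodule.span ℂ {v : (quasiSplit (↥(maximalRealSubfield L)) L (IsCMField.complexConj L) 2).L2 μ |
        ∃ (f : ℝ → ℂ) (_ : Continuous f) (_ : HasCompactSupport f) (_ : tsupport f ⊆ Ioi 0)
          (φ : (quasiSplit (↥(maximalRealSubfield L)) L (IsCMField.complexConj L) 2).Adelic → ℂ) (_ : φ ∈ chiSectionSpace (b : HeckeCharacter L) K' 1) (_ : Continuous φ)
          (hv : MemLp ((quasiSplit (↥(maximalRealSubfield L)) L (IsCMField.complexConj L) 2).quotFun (eisensteinSeriesU (fun g => f (borelHeight g) * φ g))) 2 μ), v = hv.toLp _}).topologicalClosure).topologicalClosure := by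
  refine ⟨finite_setOf_rayTrivial_levelTrivial hc hK'o W, fun b => (Submodule.isClosed_topologicalClosure _).completeSpace_coe,
    (cuspidal_orthogonal_inf_invariants_le_topologicalClosure_biSup_levelFamilies_named_of_bricks L μ hc ν 𝔓 hne h𝔓 K' hK'o hK'c hHK' W hW μK).trans ?_⟩
  refine Submodule.topologicalClosure_mono ?_
  refine iSup₂_le fun χ hχ => ?_
  exact (Submodule.le_topologicalClosure _).trans (le_iSup (fun b : ↥{χ : HeckeCharacter L | (∀ r : ℝ≥0ˣ, χ (posRealIdele L r) = 1) ∧ ∃ w ∈ W, ∀ u ∈ ((K'.map (MulAut.conj w).toMonoidHom).comap ((borelAdelic (↥(maximalRealSubfield L)) L (IsCMField.complexConj L) 2).subtype.comp (torusInBorel (↥(maximalRealSubfield L)) L (IsCMField.complexConj L) 2).subtype)).map (MonoidHom.mk' (fun t : torusInBorel (↥(maximalRealSubfield L)) L (IsCMField.complexConj L) 2 => diagUnit (t : borelAdelic (↥(maximalRealSubfield L)) L (IsCMField.complexConj L) 2).2 0) (fun t t' => diagUnit_torus_mul_two t t' 0)), χ u = 1} =>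
    (Submodule.span ℂ {v : (quasiSplit (↥(maximalRealSubfield L)) L (IsCMField.complexConj L) 2).L2 μ |
        ∃ (f : ℝ → ℂ) (_ : Continuous f) (_ : HasCompactSupport f) (_ : tsupport f ⊆ Ioi 0)
          (φ : (quasiSplit (↥(maximalRealSubfield L)) L (IsCMField.complexConj L) 2).Adelic → ℂ) (_ : φ ∈ chiSectionSpace (b : HeckeCharacter L) K' 1) (_ : Continuous φ)
          (hv : MemLp ((quasiSplit (↥(maximalRealSubfield L)) L (IsCMField.complexConj L) 2).quotFun (eisensteinSeriesU (fun g => f (borelHeight g) * φ g))) 2 μ), v = hv.toLp _}).topologicalClosure) ⟨χ, hχ⟩)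

end Summit.HodgeConjecture.HodgeConjecture.Cruxes.H413.K2E1PseudoEisensteinFamilyDecompositionNamedU2

end
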